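import Mathlib.GroupTheory.FreeGroup.Basic
import Mathlib.GroupTheory.Commutator.Basic
import Mathlib.GroupTheory.Index
import Mathlib.Data.ZMod.Basic
import Mathlib.Tactic.Ring
import Mathlib.Tactic.LinearCombination
import Mathlib.Data.Fin.VecNotation
import HarnessLib

/-!
# A model of the [EtTh] §1 root, part A: the Heisenberg group and the covering lattice of `F₂`

Mochizuki, *The étale theta function …*, Publ. RIMS **45** (2009) [EtTh], §1, PRIMS PDF pp. 12–16
[cite: MochizukiEtTh2009, §1 p.12]: "`Δ^Θ_X := Δ_X/[Δ_X, [Δ_X, Δ_X]]`", the `Z`-covering `Y → X`,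
and the coverings `Y_N → Y`, `Z_N → Y_N` ("`Δ^tp_Y/Δ^tp_{Y_N} ≅ ℤ/Nℤ(1)`",
"`1 → Δ_Θ ⊗ ℤ/Nℤ → Gal(Z_N/Y_N) → …`"). Layer L2 of the abc-iut cell, seat abc-iut-L2-t1 (root
owner). FIRST file of an explicit inhabitant of the L2 root interface `ThetaSetting p`
(`Setting.lean`) with the guard `IsEtThOrigin` — kernel evidence that the interface every
`∀ D : ThetaSetting p, …` statement of layers L2/L6 quantifies over is jointly satisfiable (vacuity
lane). A MODEL is consistency evidence only: it is not the tempered fundamental group of a curve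
and asserts nothing of [EtTh]; no side is taken on [IUTchIII] Cor. 3.12.

Contents (pure algebra): the Heisenberg group `Heis R` of a commutative ring (coordinates
`(x, y, z)` of the unitriangular matrix `[[1,x,z],[0,1,y],[0,0,1]]`; the discrete shadow of
`Δ^Θ_X`), functorial in `R`, finite over a finite ring; EVERY homomorphism into `Heis R` kills
`[[G, G], G]`; the surjection `heisHom : F₂ ↠ Heis ℤ` (`a ↦ (1,0,0)`, `b ↦ (0,1,0)`) from
`F₂ = FreeGroup (Fin 2)`; the normal subgroups `deltaY = {x = 0} ⊇ deltaYN N = {x = 0, N ∣ y} ⊇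
deltaZN N = {…, N ∣ z}` of `F₂` modelling `Δ^tp_Y ⊇ Δ^tp_{Y_N} ⊇ Δ^tp_{Z_N}`, with the printed
indices `[Δ_Y : Δ_{Y_N}] = N = [Δ_{Y_N} : Δ_{Z_N}]`. The only instances declared are the algebraic
structure on the NEW carrier `Heis R`; nothing is added to an existing type. -/

namespace Literature.AnabelianGeometry.EtaleTheta.SettingModel

open scoped commutatorElement

/-! ### The Heisenberg group of a commutative ring -/

/-- The **Heisenberg group** `Heis R` of a commutative ring: triples `(x, y, z)` with
`(x,y,z)·(x',y',z') = (x+x', y+y', z+z'+x·y')` (the unitriangular matrix `[[1,x,z],[0,1,y],[0,0,1]]`); for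
`R = ℤ` the discrete shadow of "`Δ^Θ_X := Δ_X/[Δ_X,[Δ_X,Δ_X]]`" ([EtTh] p. 12). [cite: MochizukiEtTh2009, §1 p.12] -/
@[ext]
structure Heis (R : Type*) where
  /-- the `(1,2)` entry -/
  x : R
  /-- the `(2,3)` entry -/
  y : R
  /-- the `(1,3)` entry -/
  z : R

namespace Heis

variable {R : Type*} [CommRing R]

/-- Multiplication of the Heisenberg group (matrix product). [folklore] -/
instance : Mul (Heis R) := ⟨fun a b => ⟨a.x + b.x, a.y + b.y, a.z + b.z + a.x * b.y⟩⟩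

/-- The identity `(0,0,0)`. [folklore] -/
instance : One (Heis R) := ⟨⟨0, 0, 0⟩⟩

/-- Inversion `(x,y,z)⁻¹ = (−x, −y, −z + x·y)`. [folklore] -/
instance : Inv (Heis R) := ⟨fun a => ⟨-a.x, -a.y, -a.z + a.x * a.y⟩⟩

/-- [cite: MochizukiEtTh2009, §1 p.12] -/ @[simp] theorem mul_x (a b : Heis R) : (a * b).x = a.x + b.x := rfl
/-- [cite: MochizukiEtTh2009, §1 p.12] -/ @[simp] theorem mul_y (a b : Heis R) : (a * b).y = a.y + b.y := rfl
/-- [cite: MochizukiEtTh2009, §1 p.12] -/ @[simp] theorem mul_z (a b : Heis R) : (a * b).z = a.z + b.z + a.x * b.y := rfl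
/-- [cite: MochizukiEtTh2009, §1 p.12] -/ @[simp] theorem one_x : (1 : Heis R).x = 0 := rfl
/-- [cite: MochizukiEtTh2009, §1 p.12] -/ @[simp] theorem one_y : (1 : Heis R).y = 0 := rfl
/-- [cite: MochizukiEtTh2009, §1 p.12] -/ @[simp] theorem one_z : (1 : Heis R).z = 0 := rfl
/-- [cite: MochizukiEtTh2009, §1 p.12] -/ @[simp] theorem inv_x (a : Heis R) : a⁻¹.x = -a.x := rfl
/-- [cite: MochizukiEtTh2009, §1 p.12] -/ @[simp] theorem inv_y (a : Heis R) : a⁻¹.y = -a.y := rfl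
/-- [cite: MochizukiEtTh2009, §1 p.12] -/ @[simp] theorem inv_z (a : Heis R) : a⁻¹.z = -a.z + a.x * a.y := rfl

/-- `Heis R` is a group. [folklore] -/
instance : Group (Heis R) where
  mul_assoc a b c := by ext <;> simp <;> ring
  one_mul a := by ext <;> simp
  mul_one a := by ext <;> simp
  inv_mul_cancel a := by ext <;> simp

/-- The commutator in coordinates: `⁅g, h⁆ = (0, 0, g.x·h.y − h.x·g.y)`. [cite: MochizukiEtTh2009, §1 p.12] -/
theorem commutatorElement_eq (g h : Heis R) :
    ⁅g, h⁆ = ⟨0, 0, g.x * h.y - h.x * g.y⟩ := by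
  rw [commutatorElement_def]
  ext <;> simp
  ring

/-- The `x`-coordinate is a homomorphism to `R` (written multiplicatively). [cite: MochizukiEtTh2009, §1 p.12] -/
def xHom : Heis R →* Multiplicative R where
  toFun a := Multiplicative.ofAdd a.x
  map_one' := rfl
  map_mul' _ _ := rfl

/-- The `y`-coordinate is a homomorphism. [cite: MochizukiEtTh2009, §1 p.12] -/
def yHom : Heis R →* Multiplicative R where
  toFun a := Multiplicative.ofAdd a.y
  map_one' := rfl
  map_mul' _ _ := rfl

/-- [cite: MochizukiEtTh2009, §1 p.12] -/
@[simp] theorem xHom_apply (a : Heis R) : xHom (R := R) a = Multiplicative.ofAdd a.x := rfl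

/-- [cite: MochizukiEtTh2009, §1 p.12] -/
@[simp] theorem yHom_apply (a : Heis R) : yHom (R := R) a = Multiplicative.ofAdd a.y := rfl

/-- Functoriality of `Heis` in the ring. [cite: MochizukiEtTh2009, §1 p.12] -/
def map {S : Type*} [CommRing S] (f : R →+* S) : Heis R →* Heis S where
  toFun a := ⟨f a.x, f a.y, f a.z⟩
  map_one' := by ext <;> simp
  map_mul' a b := by ext <;> simp

/-- [cite: MochizukiEtTh2009, §1 p.12] -/
@[simp] theorem map_apply {S : Type*} [CommRing S] (f : R →+* S) (a : Heis R) :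
    map f a = ⟨f a.x, f a.y, f a.z⟩ := rfl

/-- The centre-like subgroup `{x = 0, y = 0}` of `Heis R`. [cite: MochizukiEtTh2009, §1 p.12] -/
def zAxis : Subgroup (Heis R) where
  carrier := {a | a.x = 0 ∧ a.y = 0}
  one_mem' := ⟨rfl, rfl⟩
  mul_mem' := by
    rintro a b ⟨ha, ha'⟩ ⟨hb, hb'⟩
    exact ⟨by simp [ha, hb], by simp [ha', hb']⟩
  inv_mem' := by
    rintro a ⟨ha, ha'⟩
    exact ⟨by simp [ha], by simp [ha']⟩

/-- Elements of `{x = 0, y = 0}` are central. [cite: MochizukiEtTh2009, §1 p.12] -/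
theorem zAxis_le_center : zAxis (R := R) ≤ Subgroup.center (Heis R) := by
  rintro a ⟨ha, ha'⟩
  rw [Subgroup.mem_center_iff]
  intro g
  ext <;> simp [ha, ha', add_comm]

/-- `⁅Heis R, Heis R⁆ ⊆ {x = 0, y = 0}`. [cite: MochizukiEtTh2009, §1 p.12] -/
theorem commutator_top_le_zAxis :
    ⁅(⊤ : Subgroup (Heis R)), (⊤ : Subgroup (Heis R))⁆ ≤ zAxis (R := R) := by
  rw [Subgroup.commutator_le]
  intro g _ h _
  rw [commutatorElement_eq]
  exact ⟨rfl, rfl⟩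

/-- `Heis R` has class `≤ 2`: `⁅⁅Heis R, Heis R⁆, Heis R⁆ = 1`. [cite: MochizukiEtTh2009, §1 p.12] -/
theorem commutator_commutator_top_eq_bot :
    ⁅⁅(⊤ : Subgroup (Heis R)), (⊤ : Subgroup (Heis R))⁆, (⊤ : Subgroup (Heis R))⁆ = ⊥ := by
  rw [Subgroup.commutator_eq_bot_iff_le_centralizer]
  exact (commutator_top_le_zAxis.trans zAxis_le_center).trans
    (Subgroup.center_le_centralizer _)

/-- **Every homomorphism into a Heisenberg group kills `[[G,G],G]`** — the algebraic reason the theta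
quotient `Δ_X ↠ Δ^Θ_X = Δ_X/[Δ_X,[Δ_X,Δ_X]]` (p. 12) sees all class-2 quotients. [cite: MochizukiEtTh2009, §1 p.12] -/
theorem commutator_commutator_le_ker {G : Type*} [Group G] (φ : G →* Heis R) :
    ⁅⁅(⊤ : Subgroup G), (⊤ : Subgroup G)⁆, (⊤ : Subgroup G)⁆ ≤ φ.ker := by
  intro g hg
  rw [MonoidHom.mem_ker]
  have h1 : φ g ∈ (⁅⁅(⊤ : Subgroup G), (⊤ : Subgroup G)⁆, (⊤ : Subgroup G)⁆).map φ := ⟨g, hg, rfl⟩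
  rw [Subgroup.map_commutator, Subgroup.map_commutator] at h1
  have h2 : (⁅⁅(⊤ : Subgroup G).map φ, (⊤ : Subgroup G).map φ⁆, (⊤ : Subgroup G).map φ⁆ :
      Subgroup (Heis R)) ≤ ⁅⁅(⊤ : Subgroup (Heis R)), (⊤ : Subgroup (Heis R))⁆, (⊤ : Subgroup (Heis R))⁆ :=
    Subgroup.commutator_mono (Subgroup.commutator_mono le_top le_top) le_top
  have h3 := h2 h1
  rwa [commutator_commutator_top_eq_bot, Subgroup.mem_bot] at h3

/-- `Heis R ≃ R × R × R` (coordinates). [cite: MochizukiEtTh2009, §1 p.12] -/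
def equivProd : Heis R ≃ R × R × R where
  toFun a := (a.x, a.y, a.z)
  invFun t := ⟨t.1, t.2.1, t.2.2⟩
  left_inv _ := rfl
  right_inv _ := rfl

/-- A Heisenberg group over a finite ring is finite (the class-2 quotients `Heis (ℤ/M)`). [folklore] -/
instance [Finite R] : Finite (Heis R) := Finite.of_equiv _ (equivProd (R := R)).symm

/-- An element of `Heis ℤ` that dies in every `Heis (ℤ/M)`, `M ≥ 1`, is trivial. [cite: MochizukiEtTh2009, §1 p.12] -/
theorem eq_one_of_forall_map_eq_one (g : Heis ℤ)
    (h : ∀ M : ℕ, 0 < M → map (Int.castRingHom (ZMod M)) g = 1) : g = 1 := by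
  set M : ℕ := g.x.natAbs + g.y.natAbs + g.z.natAbs + 1 with hM
  have hM0 : 0 < M := Nat.succ_pos _
  have hg := h M hM0
  rw [Heis.ext_iff] at hg
  simp only [map_apply, one_x, one_y, one_z, Int.coe_castRingHom,
    ZMod.intCast_zmod_eq_zero_iff_dvd] at hg
  obtain ⟨hx, hy, hz⟩ := hg
  have key : ∀ t : ℤ, (M : ℤ) ∣ t → t.natAbs < M → t = 0 := fun t ht hlt =>
    Int.eq_zero_of_dvd_of_natAbs_lt_natAbs ht (by simpa using hlt)
  ext
  · exact key _ hx (by omega)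
  · exact key _ hy (by omega)
  · exact key _ hz (by omega)

/-- The generators `(1,0,0)`, `(0,1,0)` of `Heis ℤ` (images of `a, b`). [cite: MochizukiEtTh2009, §1 p.12] -/
def gen : Fin 2 → Heis ℤ := ![⟨1, 0, 0⟩, ⟨0, 1, 0⟩]

/-- Powers of an element with `x·y = 0` are computed coordinatewise (no binomial twist). [cite: MochizukiEtTh2009, §1 p.12] -/
theorem zpow_eq_of_mul_eq_zero (a : Heis ℤ) (ha : a.x * a.y = 0) (n : ℤ) :
    a ^ n = ⟨n * a.x, n * a.y, n * a.z⟩ := by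
  induction n using Int.induction_on with
  | zero => ext <;> simp
  | succ n ih =>
    rw [zpow_add_one, ih]; ext <;> simp <;> first | ring1 | linear_combination (↑n : ℤ) * ha
  | pred n ih =>
    rw [zpow_sub_one, ih]; ext <;> simp <;> first | ring1 | linear_combination ((↑n : ℤ) + 1) * ha

end Heis

/-! ### `F₂ ↠ Heis ℤ` and the covering lattice `Δ_Y ⊇ Δ_{Y_N} ⊇ Δ_{Z_N}` -/

/-- `F₂`, the free group on two generators `x₀ = a`, `x₁ = b` — the discrete shadow of "`Δ_X` … a
profinite free group on 2 generators" ([EtTh] p. 12). [cite: MochizukiEtTh2009, §1 p.12] -/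
abbrev F₂ : Type := FreeGroup (Fin 2)

/-- **`F₂ ↠ Heis ℤ`**, `a ↦ (1,0,0)`, `b ↦ (0,1,0)`: the class-2 quotient `Δ_X → Δ^Θ_X` at the discrete
level ([EtTh] p. 12). [cite: MochizukiEtTh2009, §1 p.12] -/
def heisHom : F₂ →* Heis ℤ := FreeGroup.lift Heis.gen

/-- `a ↦ (1,0,0)`. [cite: MochizukiEtTh2009, §1 p.12] -/
@[simp] theorem heisHom_of_zero : heisHom (FreeGroup.of 0) = ⟨1, 0, 0⟩ := by simp [heisHom, Heis.gen]

/-- `b ↦ (0,1,0)`. [cite: MochizukiEtTh2009, §1 p.12] -/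
@[simp] theorem heisHom_of_one : heisHom (FreeGroup.of 1) = ⟨0, 1, 0⟩ := by simp [heisHom, Heis.gen]

/-- `⁅a, b⁆ ↦ (0, 0, 1)`. [cite: MochizukiEtTh2009, §1 p.12] -/
theorem heisHom_commutator :
    heisHom ⁅FreeGroup.of (0 : Fin 2), FreeGroup.of 1⁆ = ⟨0, 0, 1⟩ := by
  rw [map_commutatorElement, heisHom_of_zero, heisHom_of_one, Heis.commutatorElement_eq]
  norm_num

/-- `heisHom` is surjective: `(x,y,z) = a^x · b^y · ⁅a,b⁆^(z − x·y)`. [cite: MochizukiEtTh2009, §1 p.12] -/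
theorem heisHom_surjective : Function.Surjective heisHom := by
  intro g
  refine ⟨FreeGroup.of 0 ^ g.x * FreeGroup.of 1 ^ g.y *
    ⁅FreeGroup.of (0 : Fin 2), FreeGroup.of 1⁆ ^ (g.z - g.x * g.y), ?_⟩
  rw [map_mul, map_mul, map_zpow, map_zpow, map_zpow, heisHom_commutator, heisHom_of_zero,
    heisHom_of_one, Heis.zpow_eq_of_mul_eq_zero _ (by simp), Heis.zpow_eq_of_mul_eq_zero _ (by simp),
    Heis.zpow_eq_of_mul_eq_zero _ (by simp)]
  ext <;> simp

/-- `Δ_Y := Ker(Δ_X ↠ Z)` at the discrete level: the words of `a`-exponent sum `0` (the preimage of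
`{x = 0}`; "`Π^tp_Y := Ker(Π^tp_X ↠ Z)`", [EtTh] p. 12). [cite: MochizukiEtTh2009, §1 p.12] -/
def deltaY : Subgroup F₂ := (Heis.xHom.comp heisHom).ker

/-- `Δ_{Y_N}`: `a`-exponent `0` and `b`-exponent `≡ 0 mod N` ("`Δ^tp_Y/Δ^tp_{Y_N} ≅ ℤ/Nℤ(1)`", [EtTh]
pp. 13, 16), as a preimage under `heisHom`. [cite: MochizukiEtTh2009, §1 p.13] -/
def heisYN (N : ℕ) : Subgroup (Heis ℤ) where
  carrier := {g | g.x = 0 ∧ (N : ℤ) ∣ g.y}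
  one_mem' := ⟨rfl, by simp⟩
  mul_mem' := by
    rintro g h ⟨hg, hg'⟩ ⟨hh, hh'⟩
    exact ⟨by simp [hg, hh], by simpa using dvd_add hg' hh'⟩
  inv_mem' := by
    rintro g ⟨hg, hg'⟩
    exact ⟨by simp [hg], by simpa using hg'.neg_right⟩

/-- `Δ_{Z_N}`: additionally the central coordinate `z ≡ 0 mod N` ("`Δ^tp_{Y_N}/Δ^tp_{Z_N} ≅ Δ_Θ ⊗ ℤ/Nℤ`",
[EtTh] pp. 14, 20). [cite: MochizukiEtTh2009, §1 p.14] -/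
def heisZN (N : ℕ) : Subgroup (Heis ℤ) where
  carrier := {g | g.x = 0 ∧ (N : ℤ) ∣ g.y ∧ (N : ℤ) ∣ g.z}
  one_mem' := ⟨rfl, by simp, by simp⟩
  mul_mem' := by
    rintro g h ⟨hg, hg', hg''⟩ ⟨hh, hh', hh''⟩
    refine ⟨by simp [hg, hh], by simpa using dvd_add hg' hh', ?_⟩
    simp only [Heis.mul_z, hg, zero_mul, add_zero]
    exact dvd_add hg'' hh''
  inv_mem' := by
    rintro g ⟨hg, hg', hg''⟩
    refine ⟨by simp [hg], by simpa using hg'.neg_right, ?_⟩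
    simp only [Heis.inv_z, hg, zero_mul, add_zero]
    exact hg''.neg_right

/-- `heisYN N` is normal: conjugation does not change `y` and keeps `x = 0`. [cite: MochizukiEtTh2009, §1 p.12] -/
theorem heisYN_normal (N : ℕ) : (heisYN N).Normal := by
  refine ⟨fun g ⟨hg, hg'⟩ h => ⟨by simp [hg], ?_⟩⟩
  simpa using hg'

/-- `heisZN N` is normal: conjugating `(0,y,z)` by `(x',y',z')` gives `(0, y, z + x'·y)` and `N ∣ y`.
[cite: MochizukiEtTh2009, §1 p.12] -/
theorem heisZN_normal (N : ℕ) : (heisZN N).Normal := by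
  refine ⟨fun g ⟨hg, hg', hg''⟩ h => ⟨by simp [hg], by simpa using hg', ?_⟩⟩
  have : (h * g * h⁻¹).z = g.z + h.x * g.y := by simp [hg]; ring
  show (N : ℤ) ∣ (h * g * h⁻¹).z
  rw [this]
  exact dvd_add hg'' (hg'.mul_left _)

/-- `Δ_{Y_N} ≤ Δ_X` at the discrete level. [cite: MochizukiEtTh2009, §1 p.13] -/
def deltaYN (N : ℕ) : Subgroup F₂ := (heisYN N).comap heisHom

/-- `Δ_{Z_N} ≤ Δ_X` at the discrete level. [cite: MochizukiEtTh2009, §1 p.14] -/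
def deltaZN (N : ℕ) : Subgroup F₂ := (heisZN N).comap heisHom

/-- `Δ_{Y_N}` is normal in `Δ_X` ("`Y_N → X` … Galois", [EtTh] p. 14). [cite: MochizukiEtTh2009, §1 p.14] -/
theorem deltaYN_normal (N : ℕ) : (deltaYN N).Normal := by
  haveI := heisYN_normal N
  exact Subgroup.Normal.comap inferInstance _

/-- `Δ_{Z_N}` is normal in `Δ_X` ("`Π^tp_X/Π^tp_{Z_N} = Gal(Z_N/X)`", [EtTh] p. 15). [cite: MochizukiEtTh2009, §1 p.15] -/
theorem deltaZN_normal (N : ℕ) : (deltaZN N).Normal := by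
  haveI := heisZN_normal N
  exact Subgroup.Normal.comap inferInstance _

/-- `Δ_{Y_1} = Δ_Y` (`Y₁ = Y`, p. 14). [cite: MochizukiEtTh2009, §1 p.14] -/
theorem deltaYN_one : deltaYN 1 = deltaY := by
  ext g
  simp [deltaYN, deltaY, heisYN, MonoidHom.mem_ker, Subgroup.mem_comap, Multiplicative.ext_iff]

/-- `Δ_{Z_1} = Δ_{Y_1}` (`Z₁ = Y₁`: `Gal(Z₁/Y₁) = Δ_Θ ⊗ ℤ/1 = 1`, p. 14). [cite: MochizukiEtTh2009, §1 p.14] -/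
theorem deltaZN_one : deltaZN 1 = deltaYN 1 := by
  ext g
  simp [deltaZN, deltaYN, heisZN, heisYN, Subgroup.mem_comap]

/-- `Δ_{Y_N} ≤ Δ_Y`. [cite: MochizukiEtTh2009, §1 p.13] -/
theorem deltaYN_le_deltaY (N : ℕ) : deltaYN N ≤ deltaY := by
  rintro g ⟨hg, -⟩
  simp [deltaY, MonoidHom.mem_ker, hg]

/-- `Δ_{Z_N} ≤ Δ_{Y_N}`. [cite: MochizukiEtTh2009, §1 p.14] -/
theorem deltaZN_le_deltaYN (N : ℕ) : deltaZN N ≤ deltaYN N := by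
  rintro g ⟨hg, hg', -⟩
  exact ⟨hg, hg'⟩

/-- `Y_M → Y` is a subcovering of `Y_N → Y` for `M ∣ N` (p. 18): `Δ_{Y_N} ≤ Δ_{Y_M}`.
[cite: MochizukiEtTh2009, §1 p.18] -/
theorem deltaYN_anti {M N : ℕ} (h : M ∣ N) : deltaYN N ≤ deltaYN M := by
  rintro g ⟨hg, hg'⟩
  exact ⟨hg, (Int.natCast_dvd_natCast.mpr h).trans hg'⟩

/-- `Z_M → Y` is a subcovering of `Z_N → Y` for `M ∣ N` (p. 18): `Δ_{Z_N} ≤ Δ_{Z_M}`.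
[cite: MochizukiEtTh2009, §1 p.18] -/
theorem deltaZN_anti {M N : ℕ} (h : M ∣ N) : deltaZN N ≤ deltaZN M := by
  rintro g ⟨hg, hg', hg''⟩
  exact ⟨hg, (Int.natCast_dvd_natCast.mpr h).trans hg', (Int.natCast_dvd_natCast.mpr h).trans hg''⟩

/-- `Ker(heisHom) ≤ Δ_{Z_N}`: everything killed in `Heis ℤ` lies in every `Δ_{Z_N}`. [cite: MochizukiEtTh2009, §1 p.12] -/
theorem ker_heisHom_le_deltaZN (N : ℕ) : heisHom.ker ≤ deltaZN N := by
  intro g hg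
  rw [MonoidHom.mem_ker] at hg
  simp [deltaZN, heisZN, Subgroup.mem_comap, hg]

/-! ### The indices `[Δ_Y : Δ_{Y_N}] = N = [Δ_{Y_N} : Δ_{Z_N}]` -/

/-- On `{x = 0, N ∣ y}` the `z`-coordinate IS a homomorphism (to `ℤ/N` … in fact to `ℤ`), since the
twist `x·y'` vanishes there. [cite: MochizukiEtTh2009, §1 p.12] -/
def Heis.zHomYN (N : ℕ) : heisYN N →* Multiplicative (ZMod N) where
  toFun g := Multiplicative.ofAdd ((g.1.z : ℤ) : ZMod N)
  map_one' := by simp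
  map_mul' g h := by
    have hg : g.1.x = 0 := g.2.1
    simp [hg, ofAdd_add]

/-- On `{x = 0}` (indeed on all of `Heis`) the `y`-coordinate mod `N` is a homomorphism. [cite: MochizukiEtTh2009, §1 p.12] -/
def Heis.yHomMod (N : ℕ) : heisYN 1 →* Multiplicative (ZMod N) where
  toFun g := Multiplicative.ofAdd ((g.1.y : ℤ) : ZMod N)
  map_one' := by simp
  map_mul' g h := by simp [ofAdd_add]

/-- The index of the kernel of a surjection onto `ℤ/N` (multiplicative) is `N`. [folklore] -/
private theorem index_ker_of_surjective_zmod {G : Type*} [Group G] {N : ℕ}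
    (f : G →* Multiplicative (ZMod N)) (hf : Function.Surjective f) : f.ker.index = N := by
  rw [Subgroup.index_ker, MonoidHom.range_eq_top.mpr hf, Subgroup.card_top]
  exact Nat.card_zmod N

/-- `[{x=0} : {x=0, N∣y}] = N` in `Heis ℤ`. [cite: MochizukiEtTh2009, §1 p.12] -/
theorem Heis.relIndex_heisYN (N : ℕ) : (heisYN N).relIndex (heisYN 1) = N := by
  have hker : (heisYN N).subgroupOf (heisYN 1) = (Heis.yHomMod N).ker := by
    ext g
    simp only [Subgroup.mem_subgroupOf, MonoidHom.mem_ker, Heis.yHomMod, MonoidHom.coe_mk,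
      OneHom.coe_mk, ofAdd_eq_one, ZMod.intCast_zmod_eq_zero_iff_dvd]
    exact ⟨fun h => h.2, fun h => ⟨g.2.1, h⟩⟩
  have hsurj : Function.Surjective (Heis.yHomMod N) := by
    intro t
    obtain ⟨y, hy⟩ := ZMod.intCast_surjective (Multiplicative.toAdd t)
    exact ⟨⟨⟨0, y, 0⟩, rfl, by simp⟩, by simp [Heis.yHomMod, hy]⟩
  rw [Subgroup.relIndex, hker]
  exact index_ker_of_surjective_zmod _ hsurj

/-- `[{x=0, N∣y} : {x=0, N∣y, N∣z}] = N` in `Heis ℤ`. [cite: MochizukiEtTh2009, §1 p.12] -/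
theorem Heis.relIndex_heisZN (N : ℕ) : (heisZN N).relIndex (heisYN N) = N := by
  have hker : (heisZN N).subgroupOf (heisYN N) = (Heis.zHomYN N).ker := by
    ext g
    simp only [Subgroup.mem_subgroupOf, MonoidHom.mem_ker, Heis.zHomYN, MonoidHom.coe_mk,
      OneHom.coe_mk, ofAdd_eq_one, ZMod.intCast_zmod_eq_zero_iff_dvd]
    exact ⟨fun h => h.2.2, fun h => ⟨g.2.1, g.2.2, h⟩⟩
  have hsurj : Function.Surjective (Heis.zHomYN N) := by
    intro t
    obtain ⟨z, hz⟩ := ZMod.intCast_surjective (Multiplicative.toAdd t)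
    exact ⟨⟨⟨0, 0, z⟩, rfl, by simp⟩, by simp [Heis.zHomYN, hz]⟩
  rw [Subgroup.relIndex, hker]
  exact index_ker_of_surjective_zmod _ hsurj

/-- **`[Δ_Y : Δ_{Y_N}] = N`** at the discrete level ("`Δ^tp_Y/Δ^tp_{Y_N} ≅ ℤ/Nℤ(1)`", [EtTh] p. 16).
[cite: MochizukiEtTh2009, §1 p.16] -/
theorem relIndex_deltaYN (N : ℕ) : (deltaYN N).relIndex (deltaYN 1) = N := by
  rw [deltaYN, deltaYN, Subgroup.relIndex_comap,
    Subgroup.map_comap_eq_self_of_surjective heisHom_surjective, Heis.relIndex_heisYN]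

/-- **`[Δ_{Y_N} : Δ_{Z_N}] = N`** at the discrete level ("`Δ^tp_{Ÿ_N}/Δ^tp_{Z̈_N} ≅ Δ_Θ ⊗ ℤ/Nℤ`",
[EtTh] pp. 14, 20). [cite: MochizukiEtTh2009, §1 p.14] -/
theorem relIndex_deltaZN (N : ℕ) : (deltaZN N).relIndex (deltaYN N) = N := by
  rw [deltaZN, deltaYN, Subgroup.relIndex_comap,
    Subgroup.map_comap_eq_self_of_surjective heisHom_surjective, Heis.relIndex_heisZN]

end Literature.AnabelianGeometry.EtaleTheta.SettingModel
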